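import Literature.NumberTheory.EllipticCurves.PAdicLFunctionFunctionalEquationProofs
import HarnessLib

/-!
# The functional equation of the Mellin transform of a symmetric bounded measure on `ℤ_p^×`

Topic `NumberTheory/EllipticCurves` (the `p`-adic `L`-function of item C19 and the Mellin transform
of `PAdicMeasureMoments` / `PAdicMeasureTransform`). The GENERIC-MEASURE form of
`subst_padicLFunction_eq_of_symmetry` (`PAdicLFunctionFunctionalEquationProofs`, which is the case of
the Mazur–Swinnerton-Dyer measure `μ_{f,α}` at a prime `p ∤ N`): Mazur–Tate–Teitelbaum 1986, §I.13
and §I.17, prove the functional equation for the `p`-adic Mellin transform of any bounded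
`ℚ_p`-valued distribution on `ℤ_p^×` that is `σ`-symmetric under an involution `x ↦ −1/(Kx)`,
`p ∤ K`. Theorems only; the proof is the tree's coefficientwise limit argument verbatim (binomial
theorem, Vandermonde, reindexing along the involution by `finsum_sum_classes_eq_mul_of_symmetry`,
`p`-adic continuity of `(x choose m)`), with the measure and the modulus `K` of the involution as
parameters. Consumed at `K = N` (good reduction, the tree's theorem) and at `K = N/p` for a prime
`p ‖ N` of multiplicative reduction (`PAdicLFunctionMultiplicativeFunctionalEquationProofs`).

* `sum_mul_riemannSum_measure_eq` — linearity of the level-`n` Riemann functional;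
* `subst_eq_of_measure_symmetry` — **`L(ι(T)) = σ · (1 + T)^c · L(T)`** for the Mellin transform
  `L` (given by convergent Riemann sums) of a bounded `σ`-symmetric `μ`, `⟨K⟩ = γ^c`,
  `ι = (1 + T)⁻¹ − 1`.

## References

* B. Mazur, J. Tate, J. Teitelbaum, *On `p`-adic analogues of the conjectures of Birch and
  Swinnerton-Dyer*, Invent. Math. 84 (1986), 1–48, §I.11–I.13, §I.17.
* R. Greenberg, *Iwasawa theory for elliptic curves*, LNM 1716 (1999), §1, pp. 67–68.
-/

noncomputable section

open Filter Topology PowerSeries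

namespace Literature.NumberTheory.EllipticCurves

variable {p : ℕ} [Fact p.Prime]

/-- **Linearity of the Riemann sums of a measure in the integrand**: a finite combination
`∑_{d ∈ S} κ_d RS(d, n)` of the Riemann sums `RS(d, n) = ∑_{η, s} μ(η γ^s + p^{n+e₀}ℤ_p) (s choose d)`
is the Riemann sum of `s ↦ ∑_{d ∈ S} κ_d (s choose d)` (generic form of `sum_mul_padicLRiemannSum_eq`).
[folklore] -/
private theorem sum_mul_riemannSum_measure_eq (μ : (n : ℕ) → ZMod (p ^ n) → ℚ_[p]) (n : ℕ) (S : Finset ℕ)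
    (κ : ℕ → ℚ_[p]) :
    ∑ d ∈ S, κ d * ∑ᶠ η : rootsOfUnity (torsionOrder p) ℤ_[p], ∑ s : ZMod (p ^ n),
        μ (n + cyclotomicExponent p)
            (PadicInt.toZModPow (n + cyclotomicExponent p) ((η : ℤ_[p]ˣ) : ℤ_[p]) *
              (cyclotomicGenerator p : ZMod (p ^ (n + cyclotomicExponent p))) ^ s.val) *
          ((s.val.choose d : ℕ) : ℚ_[p]) =
      ∑ᶠ η : rootsOfUnity (torsionOrder p) ℤ_[p], ∑ s : ZMod (p ^ n),
        μ (n + cyclotomicExponent p)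
            (PadicInt.toZModPow (n + cyclotomicExponent p) ((η : ℤ_[p]ˣ) : ℤ_[p]) *
              (cyclotomicGenerator p : ZMod (p ^ (n + cyclotomicExponent p))) ^ s.val) *
          ∑ d ∈ S, κ d * ((s.val.choose d : ℕ) : ℚ_[p]) := by
  classical
  haveI := neZero_torsionOrder p
  haveI := Fintype.ofFinite (rootsOfUnity (torsionOrder p) ℤ_[p])
  simp only [finsum_eq_sum_of_fintype, Finset.mul_sum]
  rw [Finset.sum_comm]
  refine Finset.sum_congr rfl fun η _ ↦ ?_
  rw [Finset.sum_comm]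
  refine Finset.sum_congr rfl fun s _ ↦ Finset.sum_congr rfl fun d _ ↦ ?_
  ring

/-- **Functional equation of the Mellin transform of a symmetric measure** (Mazur–Tate–Teitelbaum
1986, §I.13 and §I.17, for an ARBITRARY bounded `ℚ_p`-valued distribution — the generic form of
`subst_padicLFunction_eq_of_symmetry`, which is the case `μ = μ_{f,α}`, `K = N`). Let
`μ = (μ_n)` be values on the classes modulo `p^n`, bounded (`‖μ_n(a)‖ ≤ C`); let `L = ∑ c_k T^k` with
`c_k = lim_n RS(k, n)`, `RS(k, n) = ∑_{η, s} μ_{n+e₀}(η γ^s) (s choose k)` the Riemann sums of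
`∫_{ℤ_p^×} (ℓ(x) choose k) dμ` (`hRS`, `htend`); suppose `μ_{n+e₀}(u) = σ μ_{n+e₀}(u')` whenever
`K u u' ≡ -1 (mod p^{n+e₀})` for a fixed natural number `K` (`hsym`) with `K ≡ η_K γ^{c mod p^n}
(mod p^{n+e₀})` for all `n` (`hc`, `exists_teichmuller_exponent_natCast` for `p ∤ K`; `⟨K⟩ = γ^c`).
Then `L(ι(T)) = σ · (1 + T)^c · L(T)` for every `ι` with `(1 + T)(1 + ι) = 1`. Proof: verbatim the
coefficientwise limit argument of `subst_padicLFunction_eq_of_symmetry` (binomial theorem,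
Vandermonde, reindexing along `x ↦ -1/(Kx)` by `finsum_sum_classes_eq_mul_of_symmetry`, `p`-adic
continuity of `(x choose m)`). [cite: MazurTateTeitelbaum1986Invent, §I.13 and §I.17]
[cite: GreenbergLNM1716, §1 (functional equation, pp. 67–68)] -/
theorem subst_eq_of_measure_symmetry {μ : (n : ℕ) → ZMod (p ^ n) → ℚ_[p]}
    {RS : ℕ → ℕ → ℚ_[p]}
    (hRS : ∀ k n, RS k n = ∑ᶠ η : rootsOfUnity (torsionOrder p) ℤ_[p], ∑ s : ZMod (p ^ n),
      μ (n + cyclotomicExponent p)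
          (PadicInt.toZModPow (n + cyclotomicExponent p) ((η : ℤ_[p]ˣ) : ℤ_[p]) *
            (cyclotomicGenerator p : ZMod (p ^ (n + cyclotomicExponent p))) ^ s.val) *
        ((s.val.choose k : ℕ) : ℚ_[p]))
    (hbdd : ∃ C : ℝ, ∀ (n : ℕ) (a : ZMod (p ^ n)), ‖μ n a‖ ≤ C)
    {L : ℚ_[p]⟦X⟧} (htend : ∀ k : ℕ, Tendsto (RS k) atTop (𝓝 (coeff k L)))
    {σ : ℚ_[p]} {K : ℕ}
    (hsym : ∀ (n : ℕ) (u u' : ZMod (p ^ (n + cyclotomicExponent p))),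
      (K : ZMod (p ^ (n + cyclotomicExponent p))) * u * u' = -1 →
        μ (n + cyclotomicExponent p) u = σ * μ (n + cyclotomicExponent p) u')
    {ηK : rootsOfUnity (torsionOrder p) ℤ_[p]} {c : ℤ_[p]}
    (hc : ∀ n : ℕ, PadicInt.toZModPow (n + cyclotomicExponent p) ((ηK : ℤ_[p]ˣ) : ℤ_[p]) *
        (cyclotomicGenerator p : ZMod (p ^ (n + cyclotomicExponent p))) ^ (PadicInt.toZModPow n c).val =
          (K : ZMod (p ^ (n + cyclotomicExponent p))))
    {ι : ℚ_[p]⟦X⟧} (hι : (1 + X : ℚ_[p]⟦X⟧) * (ι + 1) = 1) :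
    PowerSeries.subst ι L = C σ * PowerSeries.binomialSeries ℚ_[p] c * L := by
  classical
  haveI := neZero_torsionOrder p
  haveI := Fintype.ofFinite (rootsOfUnity (torsionOrder p) ℤ_[p])
  obtain ⟨C, hC⟩ := hbdd
  have hC0 : 0 ≤ C := (norm_nonneg _).trans (hC 0 0)
  have hι0 := constantCoeff_eq_zero_of_one_add_X_mul hι
  ext m
  rw [coeff_subst_eq_sum_range hι0, coeff_C_mul_binomialSeries_mul]
  -- level-`n` approximants of the two sides
  set u : ℕ → ℚ_[p] := fun n ↦
    ∑ d ∈ Finset.range (m + 1), coeff m (ι ^ d) * RS d n with hu_def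
  set v : ℕ → ℚ_[p] := fun n ↦
    σ * ∑ k ∈ Finset.range (m + 1),
      algebraMap ℤ_[p] ℚ_[p] (Ring.choose c (m - k)) * RS k n with hv_def
  have hu : Tendsto u atTop
      (𝓝 (∑ d ∈ Finset.range (m + 1), coeff m (ι ^ d) * coeff d L)) :=
    tendsto_finsetSum _ fun d _ ↦ (htend d).const_mul _
  have hv : Tendsto v atTop (𝓝 (σ * ∑ k ∈ Finset.range (m + 1),
      algebraMap ℤ_[p] ℚ_[p] (Ring.choose c (m - k)) * coeff k L)) :=
    (tendsto_finsetSum _ fun k _ ↦ (htend k).const_mul _).const_mul σ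
  suffices hdiff : Tendsto (fun n ↦ u n - v n) atTop (𝓝 0) by
    exact sub_eq_zero.mp (tendsto_nhds_unique (hu.sub hv) hdiff)
  -- the estimate `‖u n - v n‖ ≤ ‖σ‖ C p^{-n} / ‖m!‖`
  have hp1 : (1 : ℝ) < p := by exact_mod_cast (Fact.out : p.Prime).one_lt
  have hbound : ∀ n, ‖u n - v n‖ ≤
      ‖σ‖ * (C * ((p : ℝ) ^ (-n : ℤ) / ‖((m.factorial : ℕ) : ℚ_[p])‖)) := by
    intro n
    -- `u n = R_n[s ↦ (-s choose m)]`, `v n = σ R_n[s ↦ ((c + s) choose m)]`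
    have huA : u n = ∑ᶠ η : rootsOfUnity (torsionOrder p) ℤ_[p], ∑ s : ZMod (p ^ n),
        μ (n + cyclotomicExponent p)
            (PadicInt.toZModPow (n + cyclotomicExponent p) ((η : ℤ_[p]ˣ) : ℤ_[p]) *
              (cyclotomicGenerator p : ZMod (p ^ (n + cyclotomicExponent p))) ^ s.val) *
          algebraMap ℤ_[p] ℚ_[p] (Ring.choose (-(s.val : ℤ_[p])) m) := by
      rw [hu_def]
      dsimp only
      simp_rw [hRS]
      rw [sum_mul_riemannSum_measure_eq]
      refine finsum_congr fun η ↦ Finset.sum_congr rfl fun s _ ↦ ?_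
      rw [sum_range_coeff_pow_mul_choose hι m s.val]
    have hvB : v n = σ * ∑ᶠ η : rootsOfUnity (torsionOrder p) ℤ_[p], ∑ s : ZMod (p ^ n),
        μ (n + cyclotomicExponent p)
            (PadicInt.toZModPow (n + cyclotomicExponent p) ((η : ℤ_[p]ˣ) : ℤ_[p]) *
              (cyclotomicGenerator p : ZMod (p ^ (n + cyclotomicExponent p))) ^ s.val) *
          algebraMap ℤ_[p] ℚ_[p] (Ring.choose (c + (s.val : ℤ_[p])) m) := by
      rw [hv_def]
      dsimp only
      simp_rw [hRS]
      rw [sum_mul_riemannSum_measure_eq]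
      congr 1
      refine finsum_congr fun η ↦ Finset.sum_congr rfl fun s _ ↦ ?_
      rw [sum_range_choose_mul_natChoose c m s.val]
    -- reindex `u n` along the involution
    have hre := finsum_sum_classes_eq_mul_of_symmetry p n (hsym n) (hc n)
      (fun s : ZMod (p ^ n) ↦ algebraMap ℤ_[p] ℚ_[p] (Ring.choose (-(s.val : ℤ_[p])) m))
    rw [huA, hvB, hre, ← mul_sub, norm_mul, finsum_eq_sum_of_fintype, finsum_eq_sum_of_fintype,
      ← Finset.sum_sub_distrib]
    refine mul_le_mul_of_nonneg_left ?_ (norm_nonneg σ)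
    refine IsUltrametricDist.norm_sum_le_of_forall_le_of_nonneg (by positivity) fun η _ ↦ ?_
    rw [← Finset.sum_sub_distrib]
    refine IsUltrametricDist.norm_sum_le_of_forall_le_of_nonneg (by positivity) fun s _ ↦ ?_
    rw [← mul_sub, norm_mul]
    refine mul_le_mul (hC _ _) ?_ (norm_nonneg _) hC0
    rw [norm_sub_rev]
    refine norm_choose_sub_choose_le_of_sub_mem_span m ?_
    rw [sub_neg_eq_add]
    exact exponent_add_val_add_val_mem_span p c n s
  -- conclusion
  have h0 : Tendsto (fun n : ℕ ↦ (p : ℝ) ^ (-n : ℤ)) atTop (𝓝 0) := by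
    have h := tendsto_pow_atTop_nhds_zero_of_lt_one (r := ((p : ℝ))⁻¹) (by positivity)
      (inv_lt_one_of_one_lt₀ hp1)
    refine h.congr fun n ↦ ?_
    rw [zpow_neg, zpow_natCast, inv_pow]
  have hK : Tendsto (fun n : ℕ ↦ ‖σ‖ * (C * ((p : ℝ) ^ (-n : ℤ) / ‖((m.factorial : ℕ) : ℚ_[p])‖)))
      atTop (𝓝 0) := by
    simpa using ((h0.div_const ‖((m.factorial : ℕ) : ℚ_[p])‖).const_mul C).const_mul ‖σ‖
  exact squeeze_zero_norm hbound hK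

end Literature.NumberTheory.EllipticCurves

end
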